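import Summits.Ventures.AbcSig.Recipes.BS04Normal

/-!
# Venture AbcSig — ROW TEMPLATES for `xⁿ + B yⁿ = z²` (census lines C2a/C2b: `B = 2^α · L`, `L` odd)

HONEST FRAMING. Fully PROVED template theorems of a COMPUTATION cell (`pub-abcsig`); CONDITIONAL on named
hypotheses, no claim on ABC or any summit. They do, once for all `B`, the elementary part of a census row of shape
`xⁿ + B yⁿ = z²` ([BS04, Thms. 1.3/1.5]-type; Ivorra–Kraus-type): a primitive solution is put into one of the cases
(i)–(v) of [BS04, pp. 26–27] according to `ord₂(B)` and the parity of `xy` (sign of `z` fixed as the case demands,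
rôles of the two terms swapped when `B` is odd and `x` is even or `x ≡ −C (mod 4)`), the level is the parameter `N`
tied to the case by the hypothesis `bs04Level κ 1 B 1 n = N` (a one-line computation in each row), and GIVEN for that
level `DataComplete` (computed) plus, per orbit, a kernel sieve certificate or a cited exclusion (the output of a
generated `Levels/N….lean`), the package `BS04Package` (cited) yields the contradiction.

Branch theorems (one level each): `branch_v7` (`2⁷ ∣ B yⁿ`: `ord₂ B ≥ 7` or `y` even), `branch_v6` (`ord₂(B yⁿ) = 6`),
`branch_iv45`, `branch_iv3`, `branch_iiB` (`xy` odd, `ord₂ B ∈ {4,5}, 3, 1`), `branch_iii` (`ord₂ B = 2`, two levels),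
`branch_i_odd` (`B` odd, `xy` odd; uses `case_i_or_swap`), `branch_even_Bodd` (`B` odd, `xy` even). The family
predicate of the cited exclusions is "coefficients `{1, B}` in either order, `C = 1`, exponent `n`" plus the branch
condition. Standing hypotheses of [BS04] are explicit: `n ≥ 7` prime, `n ∤ B`, `B` `n`-th-power free.

Reference: [BS04] M. A. Bennett, C. M. Skinner, Canad. J. Math. 56 (2004) 23–54, §§2–4.
-/

namespace Summit.Ventures.AbcSig

/-- For odd `c` and odd `t`, one of `±c` is congruent to `t` modulo `4`. -/
theorem exists_sign_sub_four_dvd_int (c t : ℤ) (hc : ¬ 2 ∣ c) (ht : ¬ 2 ∣ t) :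
    ∃ c' : ℤ, (c' = c ∨ c' = -c) ∧ (4 : ℤ) ∣ c' - t := by
  by_cases h : (4 : ℤ) ∣ c - t
  · exact ⟨c, Or.inl rfl, h⟩
  · exact ⟨-c, Or.inr rfl, by omega⟩

/-- In a primitive solution of `xⁿ + B yⁿ = z²` with `B y` even, `z` is odd. -/
theorem odd_z_of_two_dvd_By {B n : ℕ} {x y z : ℤ} (h : IsPrimitiveSolution 1 B 1 n x y z) (h2 : 2 ∣ (B : ℤ) * y) :
    ¬ 2 ∣ z := by
  intro hz
  obtain ⟨-, -, -, -, -, -, hbc⟩ := h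
  have hu := hbc.isUnit_of_dvd' h2 (by simpa using hz)
  rcases Int.isUnit_iff.mp hu with h | h <;> omega

/-- `2 ∣ B yⁿ` implies `2 ∣ B y`. -/
theorem two_dvd_By_of_pow {B n : ℕ} {y : ℤ} (h : 2 ∣ (B : ℤ) * y ^ n) : 2 ∣ (B : ℤ) * y := by
  rcases Int.prime_two.dvd_mul.mp h with h | h
  · exact h.mul_right y
  · exact Dvd.dvd.mul_left (Int.prime_two.dvd_of_dvd_pow h) _

/-- The `n`-th-power-freeness input of `BS04Package` for `(A, B) = (1, B)` from that of `B`. -/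
theorem nthPowerFree_one (B n : ℕ) (hn : 1 ≤ n) (hB : ∀ q : ℕ, q.Prime → ¬ q ^ n ∣ B) :
    ∀ q : ℕ, q.Prime → ¬ q ^ n ∣ 1 ∧ ¬ q ^ n ∣ B := by
  intro q hq
  refine ⟨?_, hB q hq⟩
  intro h
  have h1 := Nat.dvd_one.mp h
  rw [Nat.pow_eq_one] at h1
  rcases h1 with h1 | h1
  · exact hq.one_lt.ne' h1
  · omega

/-- The common final step: a datum `S` in case `κ` at level `N` with complete data and per-orbit certificates or
exclusions (for a family containing `S`) contradicts `BS04Package`. -/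
theorem no_solution_in_case (M : NewformModel) (hP : M.BS04Package) (S : FreyDatum) (κ : FreyCase) (N : ℕ)
    (hA : 0 < S.A) (hB : 0 < S.B) (hC : 0 < S.C) (hsq : Squarefree S.C) (hn : S.n.Prime) (h7 : 7 ≤ S.n)
    (hndvd : ¬ S.n ∣ S.A * S.B * S.C) (hfree : ∀ q : ℕ, q.Prime → ¬ q ^ S.n ∣ S.A ∧ ¬ q ^ S.n ∣ S.B)
    (hsol : IsPrimitiveSolution S.A S.B S.C S.n S.a S.b S.c) (hab1 : S.a * S.b ≠ 1) (hab2 : S.a * S.b ≠ -1)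
    (hcase : κ.Holds S.A S.B S.C S.n S.a S.b S.c) (hN : bs04Level κ S.A S.B S.C S.n = N)
    {orbs : List OrbitData} (hD : M.DataComplete N orbs) (fam : FreyDatum → Prop) (hfam : fam S)
    (hS : ∀ o ∈ orbs, (∀ e ∈ o.coeffs, e.ell.Prime ∧ e.ell ≠ 2 ∧ ¬ e.ell ∣ N) ∧
      (o.Eliminated bs04Allowed S.n ∨ M.Excludes N o fam)) : False := by
  obtain ⟨hlev, hmod⟩ := hP S κ hA hB hC hsq hn h7 hndvd hfree hsol hab1 hab2 hcase
  obtain ⟨f, hf⟩ := hlev N hN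
  exact M.no_newform_arises orbs hD fam S hfam bs04Allowed hS f hf (hmod N f hf)

/-- The family predicate used by the `B`-templates: coefficients `(1, B)` — or `(B, 1)` with the variables swapped —
`C = 1`, exponent `n`, and a row-chosen condition `P x y` on the solution in the ORIGINAL orientation `xⁿ + B yⁿ = z²`
(e.g. the parity/branch condition under which the cited exclusion is claimed). -/
def famB (B n : ℕ) (P : ℤ → ℤ → Prop) (S : FreyDatum) : Prop :=
  ((S.A = 1 ∧ S.B = B ∧ P S.a S.b) ∨ (S.A = B ∧ S.B = 1 ∧ P S.b S.a)) ∧ S.C = 1 ∧ S.n = n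

/-- `|xy| = 1` never gives a solution of `xⁿ + B yⁿ = z²`-type data with `xy ≠ ±1` — bookkeeping: from a branch
parity hypothesis. If `xy` is even then `xy ≠ ±1`. -/
theorem ne_pm_one_of_even {x y : ℤ} (h : 2 ∣ x * y) : x * y ≠ 1 ∧ x * y ≠ -1 := by
  constructor <;> intro h' <;> rw [h'] at h <;> omega

/-- **Branch (v₇): `2⁷ ∣ B yⁿ`** (i.e. `ord₂ B ≥ 7`, or `y` even with `n ≥ 7`). Level `N = bs04Level v₇ 1 B 1 n`. -/
theorem branch_v7 (B : ℕ) (hB : 0 < B) (M : NewformModel) (hP : M.BS04Package) (n : ℕ) (hn : n.Prime)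
    (h7 : 7 ≤ n) (hnB : ¬ n ∣ B) (hfreeB : ∀ q : ℕ, q.Prime → ¬ q ^ n ∣ B) (N : ℕ)
    (hN : bs04Level .v₇ 1 B 1 n = N) (P : ℤ → ℤ → Prop) {orbs : List OrbitData}
    (hD : M.DataComplete N orbs)
    (hS : ∀ o ∈ orbs, (∀ e ∈ o.coeffs, e.ell.Prime ∧ e.ell ≠ 2 ∧ ¬ e.ell ∣ N) ∧
      (o.Eliminated bs04Allowed n ∨ M.Excludes N o (famB B n P)))
    (x y z : ℤ) (hPxy : P x y) (hv : (2 : ℤ) ^ 7 ∣ B * y ^ n) (hxy1 : x * y ≠ 1)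
    (hxy2 : x * y ≠ -1) :
    ¬ IsPrimitiveSolution 1 B 1 n x y z := by
  intro hsol
  have h2 : 2 ∣ (B : ℤ) * y := two_dvd_By_of_pow ((dvd_pow_self 2 (by norm_num)).trans hv)
  have hz := odd_z_of_two_dvd_By hsol h2
  obtain ⟨z', hz'sgn, hz'⟩ := exists_sign_sub_four_dvd_int z 1 hz (by omega)
  have hsol' : IsPrimitiveSolution 1 B 1 n x y z' := hsol.of_sign hz'sgn
  have hcase : FreyCase.Holds .v₇ 1 B 1 n x y z' := ⟨hv, by simpa using hz'⟩
  exact no_solution_in_case M hP ⟨1, B, 1, n, x, y, z'⟩ .v₇ N one_pos hB one_pos squarefree_one hn h7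
    (by simpa using hnB) (nthPowerFree_one B n (by omega) hfreeB) hsol' hxy1 hxy2 hcase hN hD
    (famB B n P) ⟨Or.inl ⟨rfl, rfl, hPxy⟩, rfl, rfl⟩ hS

/-- **Branch (v₆): `ord₂(B yⁿ) = 6`** (`ord₂ B = 6`, `y` odd). Level `N = bs04Level v₆ 1 B 1 n`. -/
theorem branch_v6 (B : ℕ) (hB : 0 < B) (M : NewformModel) (hP : M.BS04Package) (n : ℕ) (hn : n.Prime)
    (h7 : 7 ≤ n) (hnB : ¬ n ∣ B) (hfreeB : ∀ q : ℕ, q.Prime → ¬ q ^ n ∣ B) (N : ℕ)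
    (hN : bs04Level .v₆ 1 B 1 n = N) (P : ℤ → ℤ → Prop) {orbs : List OrbitData}
    (hD : M.DataComplete N orbs)
    (hS : ∀ o ∈ orbs, (∀ e ∈ o.coeffs, e.ell.Prime ∧ e.ell ≠ 2 ∧ ¬ e.ell ∣ N) ∧
      (o.Eliminated bs04Allowed n ∨ M.Excludes N o (famB B n P)))
    (x y z : ℤ) (hPxy : P x y) (hv : OrdTwoEq (B * y ^ n) 6) (hxy1 : x * y ≠ 1)
    (hxy2 : x * y ≠ -1) :
    ¬ IsPrimitiveSolution 1 B 1 n x y z := by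
  intro hsol
  have h2 : 2 ∣ (B : ℤ) * y := two_dvd_By_of_pow ((dvd_pow_self 2 (by norm_num)).trans hv.1)
  have hz := odd_z_of_two_dvd_By hsol h2
  obtain ⟨z', hz'sgn, hz'⟩ := exists_sign_sub_four_dvd_int z 1 hz (by omega)
  have hsol' : IsPrimitiveSolution 1 B 1 n x y z' := hsol.of_sign hz'sgn
  have hcase : FreyCase.Holds .v₆ 1 B 1 n x y z' := ⟨hv, by simpa using hz'⟩
  exact no_solution_in_case M hP ⟨1, B, 1, n, x, y, z'⟩ .v₆ N one_pos hB one_pos squarefree_one hn h7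
    (by simpa using hnB) (nthPowerFree_one B n (by omega) hfreeB) hsol' hxy1 hxy2 hcase hN hD
    (famB B n P) ⟨Or.inl ⟨rfl, rfl, hPxy⟩, rfl, rfl⟩ hS

/-- **Branch (iv), `ord₂ B ∈ {4, 5}`, `xy` odd.** Level `N = bs04Level iv₄₅ 1 B 1 n`. -/
theorem branch_iv45 (B : ℕ) (hB : 0 < B) (M : NewformModel) (hP : M.BS04Package) (n : ℕ) (hn : n.Prime)
    (h7 : 7 ≤ n) (hnB : ¬ n ∣ B) (hfreeB : ∀ q : ℕ, q.Prime → ¬ q ^ n ∣ B) (N : ℕ)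
    (hN : bs04Level .iv₄₅ 1 B 1 n = N) (P : ℤ → ℤ → Prop) {orbs : List OrbitData}
    (hD : M.DataComplete N orbs)
    (hS : ∀ o ∈ orbs, (∀ e ∈ o.coeffs, e.ell.Prime ∧ e.ell ≠ 2 ∧ ¬ e.ell ∣ N) ∧
      (o.Eliminated bs04Allowed n ∨ M.Excludes N o (famB B n P)))
    (x y z : ℤ) (hPxy : P x y) (hB45 : OrdTwoEq B 4 ∨ OrdTwoEq B 5) (hxy : ¬ 2 ∣ x * y)
    (h1 : x * y ≠ 1) (h2 : x * y ≠ -1) :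
    ¬ IsPrimitiveSolution 1 B 1 n x y z := by
  intro hsol
  have hB2 : 2 ∣ (B : ℤ) := by
    rcases hB45 with h | h
    · exact (dvd_pow_self 2 (by norm_num)).trans h.1
    · exact (dvd_pow_self 2 (by norm_num)).trans h.1
  have hz := odd_z_of_two_dvd_By hsol (hB2.mul_right y)
  obtain ⟨z', hz'sgn, hz'⟩ := exists_sign_sub_four_dvd_int z 1 hz (by omega)
  have hsol' : IsPrimitiveSolution 1 B 1 n x y z' := hsol.of_sign hz'sgn
  have hcase : FreyCase.Holds .iv₄₅ 1 B 1 n x y z' := ⟨hxy, hB45, by simpa using hz'⟩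
  exact no_solution_in_case M hP ⟨1, B, 1, n, x, y, z'⟩ .iv₄₅ N one_pos hB one_pos squarefree_one hn h7
    (by simpa using hnB) (nthPowerFree_one B n (by omega) hfreeB) hsol' h1 h2 hcase hN hD
    (famB B n P) ⟨Or.inl ⟨rfl, rfl, hPxy⟩, rfl, rfl⟩ hS

/-- **Branch (iv), `ord₂ B = 3`, `xy` odd.** Level `N = bs04Level iv₃ 1 B 1 n`. -/
theorem branch_iv3 (B : ℕ) (hB : 0 < B) (M : NewformModel) (hP : M.BS04Package) (n : ℕ) (hn : n.Prime)
    (h7 : 7 ≤ n) (hnB : ¬ n ∣ B) (hfreeB : ∀ q : ℕ, q.Prime → ¬ q ^ n ∣ B) (N : ℕ)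
    (hN : bs04Level .iv₃ 1 B 1 n = N) (P : ℤ → ℤ → Prop) {orbs : List OrbitData}
    (hD : M.DataComplete N orbs)
    (hS : ∀ o ∈ orbs, (∀ e ∈ o.coeffs, e.ell.Prime ∧ e.ell ≠ 2 ∧ ¬ e.ell ∣ N) ∧
      (o.Eliminated bs04Allowed n ∨ M.Excludes N o (famB B n P)))
    (x y z : ℤ) (hPxy : P x y) (hB3 : OrdTwoEq B 3) (hxy : ¬ 2 ∣ x * y)
    (h1 : x * y ≠ 1) (h2 : x * y ≠ -1) :
    ¬ IsPrimitiveSolution 1 B 1 n x y z := by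
  intro hsol
  have hB2 : 2 ∣ (B : ℤ) := (dvd_pow_self 2 (by norm_num)).trans hB3.1
  have hz := odd_z_of_two_dvd_By hsol (hB2.mul_right y)
  obtain ⟨z', hz'sgn, hz'⟩ := exists_sign_sub_four_dvd_int z 1 hz (by omega)
  have hsol' : IsPrimitiveSolution 1 B 1 n x y z' := hsol.of_sign hz'sgn
  have hcase : FreyCase.Holds .iv₃ 1 B 1 n x y z' := ⟨hxy, hB3, by simpa using hz'⟩
  exact no_solution_in_case M hP ⟨1, B, 1, n, x, y, z'⟩ .iv₃ N one_pos hB one_pos squarefree_one hn h7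
    (by simpa using hnB) (nthPowerFree_one B n (by omega) hfreeB) hsol' h1 h2 hcase hN hD
    (famB B n P) ⟨Or.inl ⟨rfl, rfl, hPxy⟩, rfl, rfl⟩ hS

/-- **Branch (ii), `ord₂ B = 1`, `xy` odd.** Level `N = bs04Level iiB 1 B 1 n`. -/
theorem branch_iiB (B : ℕ) (hB : 0 < B) (M : NewformModel) (hP : M.BS04Package) (n : ℕ) (hn : n.Prime)
    (h7 : 7 ≤ n) (hnB : ¬ n ∣ B) (hfreeB : ∀ q : ℕ, q.Prime → ¬ q ^ n ∣ B) (N : ℕ)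
    (hN : bs04Level .iiB 1 B 1 n = N) (P : ℤ → ℤ → Prop) {orbs : List OrbitData}
    (hD : M.DataComplete N orbs)
    (hS : ∀ o ∈ orbs, (∀ e ∈ o.coeffs, e.ell.Prime ∧ e.ell ≠ 2 ∧ ¬ e.ell ∣ N) ∧
      (o.Eliminated bs04Allowed n ∨ M.Excludes N o (famB B n P)))
    (x y z : ℤ) (hPxy : P x y) (hB1 : OrdTwoEq B 1) (hxy : ¬ 2 ∣ x * y)
    (h1 : x * y ≠ 1) (h2 : x * y ≠ -1) :
    ¬ IsPrimitiveSolution 1 B 1 n x y z := by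
  intro hsol
  have hcase : FreyCase.Holds .iiB 1 B 1 n x y z := ⟨hxy, hB1⟩
  exact no_solution_in_case M hP ⟨1, B, 1, n, x, y, z⟩ .iiB N one_pos hB one_pos squarefree_one hn h7
    (by simpa using hnB) (nthPowerFree_one B n (by omega) hfreeB) hsol h1 h2 hcase hN hD
    (famB B n P) ⟨Or.inl ⟨rfl, rfl, hPxy⟩, rfl, rfl⟩ hS

/-- **Branch (iii), `ord₂ B = 2`, `xy` odd:** after fixing the sign of `z` (`z ≡ −yB/4 (mod 4)`), the datum is in
case (iii₁) (`y ≡ −B/4 (mod 4)`, level `N₁`) or (iii₂) (`y ≡ B/4 (mod 4)`, level `N₂`); both levels are needed. -/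
theorem branch_iii (B : ℕ) (hB : 0 < B) (M : NewformModel) (hP : M.BS04Package) (n : ℕ) (hn : n.Prime)
    (h7 : 7 ≤ n) (hnB : ¬ n ∣ B) (hfreeB : ∀ q : ℕ, q.Prime → ¬ q ^ n ∣ B) (N₁ N₂ : ℕ)
    (hN₁ : bs04Level .iii₁ 1 B 1 n = N₁) (hN₂ : bs04Level .iii₂ 1 B 1 n = N₂) (P : ℤ → ℤ → Prop)
    {orbs₁ orbs₂ : List OrbitData} (hD₁ : M.DataComplete N₁ orbs₁) (hD₂ : M.DataComplete N₂ orbs₂)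
    (hS₁ : ∀ o ∈ orbs₁, (∀ e ∈ o.coeffs, e.ell.Prime ∧ e.ell ≠ 2 ∧ ¬ e.ell ∣ N₁) ∧
      (o.Eliminated bs04Allowed n ∨ M.Excludes N₁ o (famB B n P)))
    (hS₂ : ∀ o ∈ orbs₂, (∀ e ∈ o.coeffs, e.ell.Prime ∧ e.ell ≠ 2 ∧ ¬ e.ell ∣ N₂) ∧
      (o.Eliminated bs04Allowed n ∨ M.Excludes N₂ o (famB B n P)))
    (x y z : ℤ) (hPxy : P x y) (hB2 : OrdTwoEq B 2) (hxy : ¬ 2 ∣ x * y)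
    (h1 : x * y ≠ 1) (h2 : x * y ≠ -1) :
    ¬ IsPrimitiveSolution 1 B 1 n x y z := by
  intro hsol
  have hy : ¬ 2 ∣ y := fun h => hxy (Dvd.dvd.mul_left h x)
  obtain ⟨h4B, h8B⟩ := hB2
  have h4 : (4 : ℤ) ∣ (B : ℤ) := by simpa using h4B
  have h8 : ¬ (8 : ℤ) ∣ (B : ℤ) := by simpa using h8B
  have h4n : 4 ∣ B := by exact_mod_cast h4
  have hBq : (B : ℤ) = 4 * ((B / 4 : ℕ) : ℤ) := by
    have : B = 4 * (B / 4) := (Nat.mul_div_cancel' h4n).symm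
    exact_mod_cast this
  have hqodd : ¬ 2 ∣ ((B / 4 : ℕ) : ℤ) := by
    intro h
    apply h8
    obtain ⟨k, hk⟩ := h
    exact ⟨k, by rw [hBq, hk]; ring⟩
  have h2By : 2 ∣ (B : ℤ) * y := by
    rw [hBq]
    exact ⟨2 * ((B / 4 : ℕ) : ℤ) * y, by ring⟩
  have hz := odd_z_of_two_dvd_By hsol h2By
  -- sign of `z`: `z' ≡ -y·(B/4) (mod 4)`
  have ht : ¬ 2 ∣ -(y * ((B / 4 : ℕ) : ℤ)) := by
    intro h
    rw [dvd_neg] at h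
    rcases Int.prime_two.dvd_mul.mp h with h | h
    · exact hy h
    · exact hqodd h
  obtain ⟨z', hz'sgn, hz'⟩ := exists_sign_sub_four_dvd_int z _ hz ht
  have hsol' : IsPrimitiveSolution 1 B 1 n x y z' := hsol.of_sign hz'sgn
  have hzc : (4 : ℤ) ∣ z' + y * ((B / 4 : ℕ) : ℤ) := by
    have : z' + y * ((B / 4 : ℕ) : ℤ) = z' - -(y * ((B / 4 : ℕ) : ℤ)) := by ring
    rw [this]; exact hz'
  -- `y ≡ ∓ (B/4)·C (mod 4)` with `C = 1`: one of the two holds since `y` and `B/4` are odd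
  by_cases hsplit : (4 : ℤ) ∣ y + ((B / 4 : ℕ) : ℤ) * ((1 : ℕ) : ℤ)
  · have hcase : FreyCase.Holds .iii₁ 1 B 1 n x y z' := ⟨hxy, ⟨h4B, h8B⟩, hzc, hsplit⟩
    exact no_solution_in_case M hP ⟨1, B, 1, n, x, y, z'⟩ .iii₁ N₁ one_pos hB one_pos squarefree_one hn h7
      (by simpa using hnB) (nthPowerFree_one B n (by omega) hfreeB) hsol' h1 h2 hcase hN₁ hD₁
      (famB B n P) ⟨Or.inl ⟨rfl, rfl, hPxy⟩, rfl, rfl⟩ hS₁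
  · have hsplit' : (4 : ℤ) ∣ y - ((B / 4 : ℕ) : ℤ) * ((1 : ℕ) : ℤ) := by
      push_cast at hsplit ⊢
      omega
    have hcase : FreyCase.Holds .iii₂ 1 B 1 n x y z' := ⟨hxy, ⟨h4B, h8B⟩, hzc, hsplit'⟩
    exact no_solution_in_case M hP ⟨1, B, 1, n, x, y, z'⟩ .iii₂ N₂ one_pos hB one_pos squarefree_one hn h7
      (by simpa using hnB) (nthPowerFree_one B n (by omega) hfreeB) hsol' h1 h2 hcase hN₂ hD₂
      (famB B n P) ⟨Or.inl ⟨rfl, rfl, hPxy⟩, rfl, rfl⟩ hS₂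

/-- **Branch (i), `B` odd, `xy` odd:** case (i) for the datum or its swap (`case_i_or_swap`); both have level
`N = bs04Level i 1 B 1 n = bs04Level i B 1 1 n`. -/
theorem branch_i_odd (B : ℕ) (hB : 0 < B) (hBodd : ¬ 2 ∣ (B : ℤ)) (M : NewformModel) (hP : M.BS04Package)
    (n : ℕ) (hn : n.Prime) (h7 : 7 ≤ n) (hnB : ¬ n ∣ B) (hfreeB : ∀ q : ℕ, q.Prime → ¬ q ^ n ∣ B) (N : ℕ)
    (hN : bs04Level .i 1 B 1 n = N) (hN' : bs04Level .i B 1 1 n = N) (P : ℤ → ℤ → Prop) {orbs : List OrbitData}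
    (hD : M.DataComplete N orbs)
    (hS : ∀ o ∈ orbs, (∀ e ∈ o.coeffs, e.ell.Prime ∧ e.ell ≠ 2 ∧ ¬ e.ell ∣ N) ∧
      (o.Eliminated bs04Allowed n ∨ M.Excludes N o (famB B n P)))
    (x y z : ℤ) (hPxy : P x y) (hxy : ¬ 2 ∣ x * y) (hxy1 : x * y ≠ 1)
    (hxy2 : x * y ≠ -1) :
    ¬ IsPrimitiveSolution 1 B 1 n x y z := by
  intro hsol
  have hnodd : Odd n := hn.odd_of_ne_two (by omega)
  have hodd5 : ¬ 2 ∣ x * y * (1 : ℕ) * (B : ℕ) * (1 : ℕ) := by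
    intro h
    have h' : (2 : ℤ) ∣ x * y * B := by simpa using h
    rcases Int.prime_two.dvd_mul.mp h' with h2 | h2
    · exact hxy h2
    · exact hBodd h2
  have hfree1 := nthPowerFree_one B n (by omega) hfreeB
  rcases case_i_or_swap hsol hnodd hodd5 with hcase | hcase
  · exact no_solution_in_case M hP ⟨1, B, 1, n, x, y, z⟩ .i N one_pos hB one_pos squarefree_one hn h7
      (by simpa using hnB) hfree1 hsol hxy1 hxy2 hcase hN hD
      (famB B n P) ⟨Or.inl ⟨rfl, rfl, hPxy⟩, rfl, rfl⟩ hS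
  · exact no_solution_in_case M hP ⟨B, 1, 1, n, y, x, z⟩ .i N hB one_pos one_pos squarefree_one hn h7
      (by simpa using hnB) (fun q hq => ⟨(hfree1 q hq).2, (hfree1 q hq).1⟩) hsol.swap
      (by rw [mul_comm]; exact hxy1) (by rw [mul_comm]; exact hxy2) hcase hN' hD
      (famB B n P) ⟨Or.inr ⟨rfl, rfl, hPxy⟩, rfl, rfl⟩ hS

/-- **Branch `B` odd, `xy` even:** the even variable's term is put second (swap if `x` is even) and the datum is in
case (v₇) (`2ⁿ ∣ yⁿ`, `n ≥ 7`); level `N = bs04Level v₇ 1 B 1 n = bs04Level v₇ B 1 1 n`. -/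
theorem branch_even_Bodd (B : ℕ) (hB : 0 < B) (M : NewformModel) (hP : M.BS04Package)
    (n : ℕ) (hn : n.Prime) (h7 : 7 ≤ n) (hnB : ¬ n ∣ B) (hfreeB : ∀ q : ℕ, q.Prime → ¬ q ^ n ∣ B) (N : ℕ)
    (hN : bs04Level .v₇ 1 B 1 n = N) (hN' : bs04Level .v₇ B 1 1 n = N) (P : ℤ → ℤ → Prop) {orbs : List OrbitData}
    (hD : M.DataComplete N orbs)
    (hS : ∀ o ∈ orbs, (∀ e ∈ o.coeffs, e.ell.Prime ∧ e.ell ≠ 2 ∧ ¬ e.ell ∣ N) ∧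
      (o.Eliminated bs04Allowed n ∨ M.Excludes N o (famB B n P)))
    (x y z : ℤ) (hPxy : P x y) (hxy : 2 ∣ x * y) :
    ¬ IsPrimitiveSolution 1 B 1 n x y z := by
  intro hsol
  obtain ⟨hxy1, hxy2⟩ := ne_pm_one_of_even hxy
  have hfree1 := nthPowerFree_one B n (by omega) hfreeB
  rcases Int.prime_two.dvd_mul.mp hxy with hx | hy
  · -- `x` even: swap, datum `(B, 1; y, x)`
    have hv : (2 : ℤ) ^ 7 ∣ (1 : ℕ) * x ^ n := by
      simpa using (pow_dvd_pow 2 h7).trans (pow_dvd_pow_of_dvd hx n)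
    have hz : ¬ 2 ∣ z := by
      intro hz
      obtain ⟨-, -, -, -, -, hac, -⟩ := hsol
      have hu := hac.isUnit_of_dvd' (by simpa using hx) (by simpa using hz)
      rcases Int.isUnit_iff.mp hu with h | h <;> omega
    obtain ⟨z', hz'sgn, hz'⟩ := exists_sign_sub_four_dvd_int z 1 hz (by omega)
    have hsol' : IsPrimitiveSolution B 1 1 n y x z' := (hsol.of_sign hz'sgn).swap
    have hcase : FreyCase.Holds .v₇ B 1 1 n y x z' := ⟨hv, by simpa using hz'⟩
    exact no_solution_in_case M hP ⟨B, 1, 1, n, y, x, z'⟩ .v₇ N hB one_pos one_pos squarefree_one hn h7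
      (by simpa using hnB) (fun q hq => ⟨(hfree1 q hq).2, (hfree1 q hq).1⟩) hsol'
      (by rw [mul_comm]; exact hxy1) (by rw [mul_comm]; exact hxy2) hcase hN' hD
      (famB B n P) ⟨Or.inr ⟨rfl, rfl, hPxy⟩, rfl, rfl⟩ hS
  · -- `y` even
    have hv : (2 : ℤ) ^ 7 ∣ (B : ℤ) * y ^ n :=
      Dvd.dvd.mul_left ((pow_dvd_pow 2 h7).trans (pow_dvd_pow_of_dvd hy n)) _
    exact branch_v7 B hB M hP n hn h7 hnB hfreeB N hN P hD hS x y z hPxy hv hxy1 hxy2 hsol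


/-! ## Arithmetic of `B = 2^a · ℓ^m` (census line C2a) -/

/-- For a prime `ℓ ≠ 2`, `m ≥ 1` and `n ≠ ℓ`: the odd part of the level for coefficients `(1, 2^a ℓ^m, 1)` is `ℓ`. -/
theorem bs04OddLevel_twoPow_primePow (ℓ a m n : ℕ) (hℓ : ℓ.Prime) (hℓ2 : ℓ ≠ 2) (hm : 1 ≤ m) (hn : n ≠ ℓ) :
    bs04OddLevel 1 (2 ^ a * ℓ ^ m) 1 n = ℓ ∧ bs04OddLevel (2 ^ a * ℓ ^ m) 1 1 n = ℓ := by
  have hB0 : 2 ^ a * ℓ ^ m ≠ 0 := mul_ne_zero (pow_ne_zero _ two_ne_zero) (pow_ne_zero _ hℓ.ne_zero)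
  have hfilt : (2 ^ a * ℓ ^ m).primeFactors.filter (fun q => q ≠ 2 ∧ q ≠ n) = {ℓ} := by
    ext p
    simp only [Finset.mem_filter, Nat.mem_primeFactors, Finset.mem_singleton]
    constructor
    · rintro ⟨⟨hp, hpd, -⟩, hp2, -⟩
      have hcop : Nat.Coprime p (2 ^ a) :=
        Nat.Coprime.pow_right a ((Nat.coprime_primes hp Nat.prime_two).mpr hp2)
      have h1 : p ∣ ℓ ^ m := hcop.dvd_of_dvd_mul_left hpd
      exact (Nat.prime_dvd_prime_iff_eq hp hℓ).mp (hp.dvd_of_dvd_pow h1)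
    · rintro rfl
      refine ⟨⟨hℓ, Dvd.dvd.mul_left (dvd_pow_self p (by omega)) _, hB0⟩, hℓ2, fun h => hn h.symm⟩
  refine ⟨?_, ?_⟩
  · simp only [bs04OddLevel, Nat.primeFactors_one, Finset.filter_empty, Finset.prod_empty, one_mul, hfilt,
      Finset.prod_singleton]
  · simp only [bs04OddLevel, Nat.primeFactors_one, Finset.filter_empty, Finset.prod_empty, mul_one, one_mul, hfilt,
      Finset.prod_singleton]

/-- Levels for `(1, 2^a ℓ^m, 1)` (and the swapped coefficients) in case `κ`: `2^{twoExp κ} · ℓ`. -/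
theorem bs04Level_twoPow_primePow (κ : FreyCase) (ℓ a m n : ℕ) (hℓ : ℓ.Prime) (hℓ2 : ℓ ≠ 2) (hm : 1 ≤ m)
    (hn : n ≠ ℓ) :
    bs04Level κ 1 (2 ^ a * ℓ ^ m) 1 n = 2 ^ κ.twoExp * ℓ ∧ bs04Level κ (2 ^ a * ℓ ^ m) 1 1 n = 2 ^ κ.twoExp * ℓ := by
  obtain ⟨h1, h2⟩ := bs04OddLevel_twoPow_primePow ℓ a m n hℓ hℓ2 hm hn
  exact ⟨by rw [bs04Level, h1], by rw [bs04Level, h2]⟩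

/-- `B = 2^a ℓ^m` with `a, m < n` is `n`-th-power free. -/
theorem nthPowerFree_twoPow_primePow (ℓ a m n : ℕ) (hℓ : ℓ.Prime) (hℓ2 : ℓ ≠ 2) (ha : a < n) (hm : m < n) :
    ∀ q : ℕ, q.Prime → ¬ q ^ n ∣ 2 ^ a * ℓ ^ m := by
  intro q hq hdvd
  by_cases hq2 : q = 2
  · subst hq2
    have hcop : Nat.Coprime (2 ^ n) (ℓ ^ m) :=
      Nat.Coprime.pow _ _ ((Nat.coprime_primes Nat.prime_two hℓ).mpr (Ne.symm hℓ2))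
    have h1 : 2 ^ n ∣ 2 ^ a := hcop.dvd_of_dvd_mul_right hdvd
    have := (Nat.pow_dvd_pow_iff_le_right (by norm_num)).mp h1
    omega
  · have hcop : Nat.Coprime (q ^ n) (2 ^ a) :=
      Nat.Coprime.pow _ _ ((Nat.coprime_primes hq Nat.prime_two).mpr hq2)
    have h1 : q ^ n ∣ ℓ ^ m := hcop.dvd_of_dvd_mul_left hdvd
    have hqℓ : q = ℓ :=
      (Nat.prime_dvd_prime_iff_eq hq hℓ).mp (hq.dvd_of_dvd_pow ((dvd_pow_self q (by omega)).trans h1))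
    subst hqℓ
    have := (Nat.pow_dvd_pow_iff_le_right hq.one_lt).mp h1
    omega

/-- A prime `n ∉ {2, ℓ}` does not divide `2^a ℓ^m`. -/
theorem not_dvd_twoPow_primePow (ℓ a m n : ℕ) (hℓ : ℓ.Prime) (hn : n.Prime) (hn2 : n ≠ 2) (hnℓ : n ≠ ℓ) :
    ¬ n ∣ 2 ^ a * ℓ ^ m := by
  intro h
  rcases (Nat.Prime.dvd_mul hn).mp h with h | h
  · exact hn2 ((Nat.prime_dvd_prime_iff_eq hn Nat.prime_two).mp (hn.dvd_of_dvd_pow h))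
  · exact hnℓ ((Nat.prime_dvd_prime_iff_eq hn hℓ).mp (hn.dvd_of_dvd_pow h))

/-- In a primitive solution of `xⁿ + B yⁿ = z²` with `B` even, `x` is odd. -/
theorem odd_x_of_even_B {B n : ℕ} {x y z : ℤ} (h : IsPrimitiveSolution 1 B 1 n x y z) (hB : 2 ∣ (B : ℤ)) :
    ¬ 2 ∣ x := by
  intro hx
  obtain ⟨-, -, -, -, hab, -, -⟩ := h
  have hu := hab.isUnit_of_dvd' (by simpa using hx) (hB.mul_right y)
  rcases Int.isUnit_iff.mp hu with h | h <;> omega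

end Summit.Ventures.AbcSig
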